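import Summits.QuantumFields.BalabanUV.T4Continuum.Support.AveragingDeficitFaceWords

/-!
# AveragingDeficitLiftMap (T⁴ programme, node NE3, row NE3-R2, gen 2) — THE LIFT MAP OF A COARSE BOND AND ITS
# INVERSION: `m ↦ pushDir L V (bondDir b₀(c) m) (c)` is `c₀·id + O(w)` on `𝔤𝔩(N, ℂ)` (`c₀ ∈ [L^{−d}, 1]`,
# `w = max_x |V(Γ_{c,x})V(c)⁻¹ − 1|`), hence injective and ONTO for `2044·L^d·w ≤ 1`, also onto `𝔲(N)` from `𝔲(N)`
# (file 3b of the non-abelian lift γ; file 3c `AveragingDeficitFaceLift` assembles the global lift)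

HONEST FRAMING (cell `pub-balaban`, T4-DAG PAGE 1; unit `b2b-balaban-t4-ne3r2-p1` = owner of BINDER-OWNERS row NE3-R2,
gen 2).  The cell's T4 target is the finite-torus continuum limit of the unit-scale averaged loop expectations — NOT
infinite volume, NO mass gap, NOT Clay, NOT summit progress.  On the NE3 energy route (`T4ConvexResponse` §4) the dual
energy norm of the coarse residual is bounded by `residual_pairing` + the wall β (PROVED: `deficitDerivWall(Per)_holds`) +
the LIFT γ (`TangentLift`): every coarse direction `φ` is the push-forward of a fine direction of comparable size.  For
Bałaban's NON-LINEAR average (42) the push-forward is `AveragingDeficitResidualPairing.pushDir`; this file inverts it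
bond by bond (record `t4/T4-EST-NE3-P2.md` §4 (γ1) «algebraic lift», there for the linearised covariant average and
[analysis]; here for the non-linear average, kernel-checked, all [folklore], 0 sorry): §1 the one-bond direction `bondDir`,
the loop bound `LoopBound`, the linear map `liftMap (y,κ)` (linear by file 2) and the leading coefficient
`axisWeight = Σ_x L^{−d}[x on the axis of c] ∈ [L^{−d}, 1]`; §2 THE ESTIMATE **`norm_liftMap_sub_le`**:
`|liftMap m − c₀·m| ≤ 1022·w·|m|` for `w ≤ 1/32` — from file 3a: along the `L^d` loops of (42) the one-bond direction is
seen as `Z_x = χ_x·Ad_{W_x⁻¹}M − M` EXACTLY (`M = Ad_{V(Γ_c)}m`), so `(log W_x)′ = J_{X_x}⁻¹Z_x = (χ_x − 1)M + O(w)|m|`,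
`X_c′ = (c₀ − 1)M + O(w)|m|`, `Φ(c) = m + Ad_{V(Γ_c)⁻¹}J_{X_c}(X_c′) = c₀·m + O(w)|m|` (constants `2 + 510 + 510`);
§3 INVERSION: `norm_liftMap_ge` (`|liftMap m| ≥ ½L^{−d}|m|` for `2044·L^d·w ≤ 1`), **`exists_preimage`** and
**`exists_preimage_skew`** (finite dimension: `LinearMap.injective_iff_surjective`, on `𝔤𝔩(N)` and on Mathlib's real
submodule `skewAdjoint.submodule ℝ 𝕄` of skew-adjoint matrices, which `liftMap` preserves), with `|m| ≤ 2L^d|φ(c)|`.  NE3 ITSELF IS NOT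
PROVED (energy route: NE3(A) ⇐ ML ∧ R0 ∧ β ∧ γ); NE3 stays COND-free.
CITATION HEADER: no printed sentence is a hypothesis; the manuscripts under audit are not cited for any disputed step;
context: T. Bałaban, Commun. Math. Phys. **98** (1985) 17–51 [Balaban1985Averaging] ((42) p. 23, p. 25),
**102** (1985) 277–309 [Balaban1985Variational] ((75)–(76) p. 289: the constraints being lifted).
PLACEMENT: `Summits/QuantumFields/BalabanUV/` (human rule 2026-08-19).  Record: HOME `t4/T4-EST-NE3-R2.md` v0.3.
-/

set_option autoImplicit false

open scoped BigOperators Matrix Matrix.Norms.L2Operator Topology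
open NormedSpace Finset Filter

namespace Summit.QuantumFields.BalabanUV.T4Continuum.AveragingDeficitLiftMap

open Literature.MathematicalPhysics.QuantumFieldTheory.Balaban1983to89
open B7Prop1Explicit B7Prop2Explicit MatrixLog UnitaryModel
open T4AveragingDeficitWall hiding Site Plane Plaq Bond
open T4AveragingDeficitNonAbelian (Ad_mul Ad_sub)
open AveragingDeficitTransport AveragingDeficitLocality AveragingDeficitNearIdentity AveragingDeficitSideDeriv
open AveragingDeficitResidualPairing AveragingDeficitTransportCalc AveragingDeficitPushForwardLinear
open AveragingDeficitFaceWords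

noncomputable section

variable {d : ℕ} {n : Type*} [Fintype n] [DecidableEq n]

local notation "𝕄" => Matrix n n ℂ
local notation "Site" => B7Prop1Explicit.Site

/-! ## §1 The one-bond direction and the lift map of a coarse bond -/

/-- The direction with value `m` on the bond `(z₀, i₀)` and `0` elsewhere. [folklore] -/
def bondDir (z₀ : Site d) (i₀ : Fin d) (m : 𝕄) : Site d → Fin d → 𝕄 := fun z i => if z = z₀ ∧ i = i₀ then m else 0

omit [Fintype n] [DecidableEq n] in
/-- Value on the bond. [folklore] -/
@[simp] theorem bondDir_self (z₀ : Site d) (i₀ : Fin d) (m : 𝕄) : bondDir z₀ i₀ m z₀ i₀ = m := by simp [bondDir]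

omit [Fintype n] [DecidableEq n] in
/-- Value off the bond. [folklore] -/
theorem bondDir_of_ne {z₀ z : Site d} {i₀ i : Fin d} (m : 𝕄) (h : (z, i) ≠ (z₀, i₀)) : bondDir z₀ i₀ m z i = 0 := by
  unfold bondDir
  rw [if_neg]
  rintro ⟨rfl, rfl⟩
  exact h rfl

omit [Fintype n] [DecidableEq n] in
/-- The one-bond direction on a face bond is face-supported. [folklore] -/
theorem faceSupported_bondDir (L : ℕ) (y : Site d) (κ : Fin d) (m : 𝕄) :
    FaceSupported L (bondDir (faceSite L y κ) κ m) := by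
  intro z i hzi
  refine bondDir_of_ne m fun h => hzi ?_
  obtain ⟨rfl, rfl⟩ := Prod.mk.injEq _ _ _ _ |>.mp h
  exact isFaceBond_faceSite L y i

omit [Fintype n] [DecidableEq n] in
/-- `bondDir` is additive in `m`. [folklore] -/
theorem bondDir_add (z₀ : Site d) (i₀ : Fin d) (m m' : 𝕄) :
    bondDir z₀ i₀ (m + m') = bondDir z₀ i₀ m + bondDir z₀ i₀ m' := by
  funext z i; simp only [bondDir, Pi.add_apply]; split_ifs <;> simp

omit [Fintype n] [DecidableEq n] in
/-- `bondDir` is real-homogeneous in `m`. [folklore] -/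
theorem bondDir_smul (z₀ : Site d) (i₀ : Fin d) (c : ℝ) (m : 𝕄) :
    bondDir z₀ i₀ (c • m) = c • bondDir z₀ i₀ m := by
  funext z i; simp only [bondDir, Pi.smul_apply]; split_ifs <;> simp

omit [Fintype n] [DecidableEq n] in
/-- `bondDir` of skew values is a `𝔲(N)` direction. [folklore] -/
theorem isSkewDir_bondDir (z₀ : Site d) (i₀ : Fin d) {m : 𝕄} (hm : m ∈ skewAdjoint 𝕄) : IsSkewDir (bondDir z₀ i₀ m) := by
  intro z i
  unfold bondDir
  split_ifs
  · exact hm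
  · exact (skewAdjoint 𝕄).zero_mem

/-- The loop bound of a coarse bond: `|V(Γ_{c,x})V(c)⁻¹ − 1| ≤ w` for all `x ∈ B(c₋)`. [cite: Balaban1985Averaging, p.25] -/
def LoopBound (L : ℕ) (V : Site d → Fin d → 𝕄ˣ) (y : Site d) (κ : Fin d) (w : ℝ) : Prop :=
  ∀ r : Fin d → Fin L, ‖((Wcx L V ((L : ℤ) • y) κ (boxVec L r) : 𝕄ˣ) : 𝕄) - 1‖ ≤ w

/-- **THE LIFT MAP of the coarse bond `c = (y, κ)`**: `m ↦ pushDir L V (bondDir b₀(c) m) (c)`, an `ℝ`-linear endomorphism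
of `𝔤𝔩(N, ℂ)` (file 2's `pushDir_add/smul`). [cite: Balaban1985Averaging, (42) p.23] -/
def liftMap (L : ℕ) (V : Site d → Fin d → 𝕄ˣ) (y : Site d) (κ : Fin d) {w : ℝ} (hw : w ≤ 1 / 32)
    (hW : LoopBound L V y κ w) : 𝕄 →ₗ[ℝ] 𝕄 where
  toFun m := pushDir L V (bondDir (faceSite L y κ) κ m) ((L : ℤ) • y) κ
  map_add' m m' := by
    simp only [bondDir_add]
    exact pushDir_add L V _ _ _ κ fun r => (hW r).trans hw
  map_smul' c m := by
    simp only [bondDir_smul, RingHom.id_apply]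
    exact pushDir_smul L V c _ _ κ fun r => (hW r).trans hw

/-- `liftMap` unfolds. [folklore] -/
theorem liftMap_apply (L : ℕ) (V : Site d → Fin d → 𝕄ˣ) (y : Site d) (κ : Fin d) {w : ℝ} (hw : w ≤ 1 / 32)
    (hW : LoopBound L V y κ w) (m : 𝕄) :
    liftMap L V y κ hw hW m = pushDir L V (bondDir (faceSite L y κ) κ m) ((L : ℤ) • y) κ := rfl

/-- The leading coefficient `c₀ = Σ_{x ∈ B(c₋)} L^{−d}·[x on the axis of c]`. [folklore] -/
def axisWeight (d L : ℕ) (κ : Fin d) : ℝ := ∑ r : Fin d → Fin L, ((L : ℝ) ^ d)⁻¹ * (if OnAxis κ r then (1 : ℝ) else 0)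

omit [Fintype n] [DecidableEq n] in
/-- `L^{−d} ≤ c₀ ≤ 1`. [folklore] -/
theorem axisWeight_bounds {L : ℕ} (hL : 1 ≤ L) (κ : Fin d) :
    ((L : ℝ) ^ d)⁻¹ ≤ axisWeight d L κ ∧ axisWeight d L κ ≤ 1 := by
  unfold axisWeight
  have hLd : (0 : ℝ) < (L : ℝ) ^ d := pow_pos (by exact_mod_cast hL) d
  constructor
  · let r₀ : Fin d → Fin L := fun _ => ⟨0, hL⟩
    have h0 : OnAxis κ r₀ := fun _ _ => rfl
    have := Finset.single_le_sum (s := Finset.univ) (f := fun r : Fin d → Fin L =>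
      ((L : ℝ) ^ d)⁻¹ * (if OnAxis κ r then (1 : ℝ) else 0)) (fun r _ => by positivity) (Finset.mem_univ r₀)
    simpa [if_pos h0] using this
  · calc _ ≤ ∑ _r : Fin d → Fin L, ((L : ℝ) ^ d)⁻¹ :=
          Finset.sum_le_sum fun r _ => by
            split_ifs <;> simp [le_of_lt (inv_pos.mpr hLd)]
      _ = 1 := sum_weights L hL

/-! ## §2 The estimate: `liftMap = c₀·id + O(w)` -/

/-- Real bookkeeping. [folklore] -/
private theorem est_aux {w nm nX nXp nJ : ℝ} (hnm : 0 ≤ nm) (hnX : 0 ≤ nX)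
    (hX : nX ≤ 2 * w) (hXp : nXp ≤ 17 * nm) (hJ : nJ ≤ 15 * nX * nXp) : nJ ≤ 510 * w * nm := by
  have h1 : nX * nXp ≤ nX * (17 * nm) := mul_le_mul_of_nonneg_left hXp hnX
  have h2 : nX * (17 * nm) ≤ (2 * w) * (17 * nm) := mul_le_mul_of_nonneg_right hX (by positivity)
  nlinarith

set_option maxHeartbeats 800000 in
/-- **THE ESTIMATE**: `|liftMap m − c₀·m| ≤ 1022·w·|m|` for `U(N)` data with loop bound `w ≤ 1/32`.
[cite: Balaban1985Averaging, (42) p.23, p.25] -/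
theorem norm_liftMap_sub_le [Nonempty n] {L : ℕ} (hL : 1 ≤ L) {V : Site d → Fin d → 𝕄ˣ} (hV : IsUnitaryCfg V)
    (y : Site d) (κ : Fin d) {w : ℝ} (hw0 : 0 ≤ w) (hw : w ≤ 1 / 32) (hW : LoopBound L V y κ w) (m : 𝕄) :
    ‖liftMap L V y κ hw hW m - axisWeight d L κ • m‖ ≤ 1022 * w * ‖m‖ := by
  letI : CStarAlgebra 𝕄 := {}
  have hLd : (0 : ℝ) < (L : ℝ) ^ d := pow_pos (by exact_mod_cast hL) d
  set q : Site d := (L : ℤ) • y with hq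
  set ψ : Site d → Fin d → 𝕄 := bondDir (faceSite L y κ) κ m with hψ_def
  have hψ : FaceSupported L ψ := faceSupported_bondDir L y κ m
  have hψm : ψ (faceSite L y κ) κ = m := bondDir_self _ _ _
  set P₀ : 𝕄ˣ := hol V q (seg κ (L : ℤ)) with hP₀
  have hP₀u : P₀ ∈ unitaryUnits 𝕄 := hol_mem_of hV _ _
  set M : 𝕄 := Ad P₀ m with hM
  have hMn : ‖M‖ = ‖m‖ := norm_Ad_of_unitary hP₀u m
  set X : 𝕄 := Xavg L V q κ with hX
  set X' : 𝕄 := XavgDeriv L V ψ q κ with hX'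
  -- per-loop quantities
  have hWu : ∀ r : Fin d → Fin L, Wcx L V q κ (boxVec L r) ∈ unitaryUnits 𝕄 := fun r =>
    (unitaryUnits 𝕄).mul_mem (hol_mem_of hV _ _) ((unitaryUnits 𝕄).inv_mem (hol_mem_of hV _ _))
  have hW1 : ∀ r : Fin d → Fin L, ‖((Wcx L V q κ (boxVec L r) : 𝕄ˣ) : 𝕄) - 1‖ < 1 := fun r =>
    (hW r).trans_lt (by linarith)
  have hXr : ∀ r : Fin d → Fin L, ‖mlog ((Wcx L V q κ (boxVec L r) : 𝕄ˣ) : 𝕄)‖ ≤ 2 * w := fun r =>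
    (norm_mlog_le_two_mul ((hW r).trans (by linarith))).trans (by linarith [hW r])
  -- `Z_r` and `Y_r`
  have hZ : ∀ r : Fin d → Fin L,
      jexp (mlog ((Wcx L V q κ (boxVec L r) : 𝕄ˣ) : 𝕄)) (mlogDeriv L V ψ q κ (boxVec L r))
        = (if OnAxis κ r then (1 : ℝ) else 0) • Ad (Wcx L V q κ (boxVec L r))⁻¹ M - M := fun r => by
    rw [jexp_mlog_eq_Ad L V ψ q κ r (hW1 r), hq, Ad_inv_Wcx_dhol_loopWord hL hψ y κ r, hψm]
  have hY : ∀ r : Fin d → Fin L,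
      ‖mlogDeriv L V ψ q κ (boxVec L r) - ((if OnAxis κ r then (1 : ℝ) else 0) - 1) • M‖ ≤ 512 * w * ‖m‖ := by
    intro r
    set W : 𝕄ˣ := Wcx L V q κ (boxVec L r) with hWdef
    set χ : ℝ := if OnAxis κ r then (1 : ℝ) else 0 with hχ
    set Y : 𝕄 := mlogDeriv L V ψ q κ (boxVec L r) with hYdef
    set Z : 𝕄 := χ • Ad W⁻¹ M - M with hZdef
    have hχ1 : |χ| ≤ 1 := by rw [hχ]; split_ifs <;> simp
    -- (E1) `Z = (χ − 1)M + χ(Ad_{W⁻¹}M − M)`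
    have hE1 : ‖Z - (χ - 1) • M‖ ≤ 2 * w * ‖m‖ := by
      have e : Z - (χ - 1) • M = χ • (Ad W⁻¹ M - M) := by rw [hZdef, sub_smul, one_smul, smul_sub]; abel
      rw [e, norm_smul, Real.norm_eq_abs]
      have hWi : ‖(((W⁻¹ : 𝕄ˣ)) : 𝕄) - 1‖ ≤ w :=
        (norm_inv_sub_one_le (mem_U1_of_unitary (hWu r))).trans (hW r)
      have h1 := norm_Ad_sub_le ((unitaryUnits 𝕄).inv_mem (hWu r)) M
      calc |χ| * ‖Ad W⁻¹ M - M‖ ≤ 1 * (2 * ‖(((W⁻¹ : 𝕄ˣ)) : 𝕄) - 1‖ * ‖M‖) :=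
            mul_le_mul hχ1 h1 (norm_nonneg _) zero_le_one
        _ ≤ 2 * w * ‖m‖ := by rw [one_mul, hMn]; gcongr
    have hZn : ‖Z‖ ≤ (1 + 2 * w) * ‖m‖ := by
      have h1 : ‖(χ - 1) • M‖ ≤ ‖m‖ := by
        rw [norm_smul, Real.norm_eq_abs, hMn]
        have : |χ - 1| ≤ 1 := by rw [hχ]; split_ifs <;> norm_num
        exact mul_le_of_le_one_left (norm_nonneg _) this
      have := norm_sub_le_norm_sub_add_norm_sub Z ((χ - 1) • M) 0
      simp only [sub_zero] at this
      linarith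
    -- (E2)–(E4) `Y = J⁻¹ Z`
    have hJ : jexp (mlog (W : 𝕄)) Y = Z := hZ r
    have hXn : ‖mlog (W : 𝕄)‖ ≤ 2 * w := hXr r
    have hX1 : ‖mlog (W : 𝕄)‖ ≤ 1 := by linarith
    have hlow := norm_le_norm_jexp (mlog (W : 𝕄)) Y hX1
    rw [hJ] at hlow
    have hYn : ‖Y‖ ≤ 17 * ‖m‖ := by
      -- `(1 − 15·2w)|Y| ≤ |Z| ≤ (1 + 2w)|m|`, `w ≤ 1/32`
      have h16 : (1 : ℝ) / 16 ≤ 1 - 15 * ‖mlog (W : 𝕄)‖ := by linarith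
      have := mul_le_mul_of_nonneg_right h16 (norm_nonneg Y)
      nlinarith [norm_nonneg Y, norm_nonneg m]
    have hE4 : ‖Y - Z‖ ≤ 510 * w * ‖m‖ := by
      have h := norm_jexp_sub_le (mlog (W : 𝕄)) Y hX1
      rw [hJ, ← norm_neg, neg_sub] at h
      exact est_aux (norm_nonneg m) (norm_nonneg _) hXn hYn h
    calc ‖Y - (χ - 1) • M‖ ≤ ‖Y - Z‖ + ‖Z - (χ - 1) • M‖ := norm_sub_le_norm_sub_add_norm_sub _ _ _
      _ ≤ 510 * w * ‖m‖ + 2 * w * ‖m‖ := add_le_add hE4 hE1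
      _ = 512 * w * ‖m‖ := by ring
  -- (E5) `X′ = (c₀ − 1)M + O(w)`
  have hE5 : ‖X' - (axisWeight d L κ - 1) • M‖ ≤ 512 * w * ‖m‖ := by
    have h1a : ∑ r : Fin d → Fin L, ((L : ℝ) ^ d)⁻¹ • ((if OnAxis κ r then (1 : ℝ) else 0) • M)
        = axisWeight d L κ • M := by
      rw [axisWeight, Finset.sum_smul]
      exact Finset.sum_congr rfl fun r _ => by rw [mul_smul]
    have h1b : ∑ _r : Fin d → Fin L, ((L : ℝ) ^ d)⁻¹ • M = M := by
      rw [← Finset.sum_smul, sum_weights L hL, one_smul]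
    have e : X' - (axisWeight d L κ - 1) • M
        = ∑ r : Fin d → Fin L, ((L : ℝ) ^ d)⁻¹ •
            (mlogDeriv L V ψ q κ (boxVec L r) - ((if OnAxis κ r then (1 : ℝ) else 0) - 1) • M) := by
      have h2 : ∑ r : Fin d → Fin L, ((L : ℝ) ^ d)⁻¹ •
            (mlogDeriv L V ψ q κ (boxVec L r) - ((if OnAxis κ r then (1 : ℝ) else 0) - 1) • M)
          = (∑ r : Fin d → Fin L, ((L : ℝ) ^ d)⁻¹ • mlogDeriv L V ψ q κ (boxVec L r))
            - (∑ r : Fin d → Fin L, ((L : ℝ) ^ d)⁻¹ • ((if OnAxis κ r then (1 : ℝ) else 0) • M)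
              - ∑ _r : Fin d → Fin L, ((L : ℝ) ^ d)⁻¹ • M) := by
        rw [← Finset.sum_sub_distrib, ← Finset.sum_sub_distrib]
        exact Finset.sum_congr rfl fun r _ => by rw [sub_smul, one_smul, smul_sub, smul_sub]
      rw [h2, h1a, h1b, hX', XavgDeriv, sub_smul, one_smul]
    rw [e]
    exact norm_avg_le L hL _ hY
  have hc := axisWeight_bounds (d := d) hL κ
  have hX'n : ‖X'‖ ≤ 17 * ‖m‖ := by
    have h1 : ‖(axisWeight d L κ - 1) • M‖ ≤ ‖m‖ := by
      rw [norm_smul, Real.norm_eq_abs, hMn]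
      have : |axisWeight d L κ - 1| ≤ 1 := by
        rw [abs_le]; constructor <;> nlinarith [hc.1, hc.2, inv_pos.mpr hLd]
      exact mul_le_of_le_one_left (norm_nonneg _) this
    have := norm_sub_le_norm_sub_add_norm_sub X' ((axisWeight d L κ - 1) • M) 0
    simp only [sub_zero] at this
    have : 512 * w * ‖m‖ ≤ 16 * ‖m‖ := by nlinarith [norm_nonneg m]
    linarith
  -- (E7) `J_X(X′) = X′ + O(w)`
  have hXn : ‖X‖ ≤ 2 * w := norm_Xavg_le L hL V q κ (hw.trans (by norm_num)) hW
  have hE7 : ‖jexp X X' - X'‖ ≤ 510 * w * ‖m‖ :=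
    est_aux (norm_nonneg m) (norm_nonneg _) hXn hX'n (norm_jexp_sub_le X X' (by linarith))
  -- (E8) assemble
  have hform : liftMap L V y κ hw hW m - axisWeight d L κ • m = Ad P₀⁻¹ (jexp X X' - (axisWeight d L κ - 1) • M) := by
    rw [liftMap_apply, ← hψ_def, ← hq, pushDir_faceSupported hL hψ y κ, hψm, ← hq, ← hP₀, ← hX, ← hX', Ad_sub,
      Ad_real_smul, hM, ← Ad_mul, inv_mul_cancel, Ad_one, sub_smul, one_smul]
    abel
  rw [hform, norm_Ad_of_unitary ((unitaryUnits 𝕄).inv_mem hP₀u)]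
  calc ‖jexp X X' - (axisWeight d L κ - 1) • M‖
      ≤ ‖jexp X X' - X'‖ + ‖X' - (axisWeight d L κ - 1) • M‖ := norm_sub_le_norm_sub_add_norm_sub _ _ _
    _ ≤ 510 * w * ‖m‖ + 512 * w * ‖m‖ := add_le_add hE7 hE5
    _ = 1022 * w * ‖m‖ := by ring

/-! ## §3 Inversion -/

/-- **LOWER BOUND**: `|liftMap m| ≥ ½L^{−d}|m|` when `2044·L^d·w ≤ 1`. [folklore] -/
theorem norm_liftMap_ge [Nonempty n] {L : ℕ} (hL : 1 ≤ L) {V : Site d → Fin d → 𝕄ˣ} (hV : IsUnitaryCfg V)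
    (y : Site d) (κ : Fin d) {w : ℝ} (hw0 : 0 ≤ w) (hwL : 2044 * (L : ℝ) ^ d * w ≤ 1) (hw : w ≤ 1 / 32)
    (hW : LoopBound L V y κ w) (m : 𝕄) :
    ((L : ℝ) ^ d)⁻¹ / 2 * ‖m‖ ≤ ‖liftMap L V y κ hw hW m‖ := by
  have hLd : (0 : ℝ) < (L : ℝ) ^ d := pow_pos (by exact_mod_cast hL) d
  have h1 := norm_liftMap_sub_le hL hV y κ hw0 hw hW m
  have hc := (axisWeight_bounds (d := d) hL κ).1
  have h2 : ‖axisWeight d L κ • m‖ ≥ ((L : ℝ) ^ d)⁻¹ * ‖m‖ := by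
    rw [norm_smul, Real.norm_eq_abs, abs_of_nonneg ((inv_pos.mpr hLd).le.trans hc)]
    exact mul_le_mul_of_nonneg_right hc (norm_nonneg _)
  have h3 : ‖axisWeight d L κ • m‖ ≤ ‖liftMap L V y κ hw hW m‖ + ‖liftMap L V y κ hw hW m - axisWeight d L κ • m‖ := by
    have := norm_sub_le (liftMap L V y κ hw hW m) (liftMap L V y κ hw hW m - axisWeight d L κ • m)
    rwa [sub_sub_cancel] at this
  have h4 : 1022 * w * ‖m‖ ≤ ((L : ℝ) ^ d)⁻¹ / 2 * ‖m‖ := by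
    refine mul_le_mul_of_nonneg_right ?_ (norm_nonneg _)
    rw [inv_eq_one_div, div_div, le_div_iff₀ (by positivity)]
    linarith
  linarith

/-- **INJECTIVITY ⇒ SURJECTIVITY**: every `φ(c)` has a preimage `m` with `|m| ≤ 2L^d|φ(c)|`. [folklore] -/
theorem exists_preimage [Nonempty n] {L : ℕ} (hL : 1 ≤ L) {V : Site d → Fin d → 𝕄ˣ} (hV : IsUnitaryCfg V)
    (y : Site d) (κ : Fin d) {w : ℝ} (hw0 : 0 ≤ w) (hwL : 2044 * (L : ℝ) ^ d * w ≤ 1) (hw : w ≤ 1 / 32)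
    (hW : LoopBound L V y κ w) (φ : 𝕄) :
    ∃ m : 𝕄, liftMap L V y κ hw hW m = φ ∧ ‖m‖ ≤ 2 * (L : ℝ) ^ d * ‖φ‖ := by
  have hLd : (0 : ℝ) < (L : ℝ) ^ d := pow_pos (by exact_mod_cast hL) d
  have hinj : Function.Injective (liftMap L V y κ hw hW) := by
    intro m m' h
    have h1 := norm_liftMap_ge hL hV y κ hw0 hwL hw hW (m - m')
    rw [map_sub, h, sub_self, norm_zero] at h1
    have h2 : ‖m - m'‖ ≤ 0 := by
      by_contra hc
      have : 0 < ((L : ℝ) ^ d)⁻¹ / 2 * ‖m - m'‖ := mul_pos (by positivity) (lt_of_not_ge hc)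
      linarith
    exact sub_eq_zero.mp (norm_le_zero_iff.mp h2)
  obtain ⟨m, hm⟩ := (LinearMap.injective_iff_surjective.mp hinj) φ
  refine ⟨m, hm, ?_⟩
  have h1 := norm_liftMap_ge hL hV y κ hw0 hwL hw hW m
  rw [hm] at h1
  have e : 2 * (L : ℝ) ^ d * (((L : ℝ) ^ d)⁻¹ / 2 * ‖m‖) = ‖m‖ := by field_simp
  calc ‖m‖ = 2 * (L : ℝ) ^ d * (((L : ℝ) ^ d)⁻¹ / 2 * ‖m‖) := e.symm
    _ ≤ 2 * (L : ℝ) ^ d * ‖φ‖ := mul_le_mul_of_nonneg_left h1 (by positivity)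

/-- The lift map preserves skew-adjointness (`Φ` of a `𝔲(N)` direction is `𝔲(N)`-valued). [folklore] -/
theorem liftMap_mem_skew {L : ℕ} {V : Site d → Fin d → 𝕄ˣ} (hV : IsUnitaryCfg V) (y : Site d) (κ : Fin d)
    {w : ℝ} (hw : w ≤ 1 / 32) (hW : LoopBound L V y κ w) {m : 𝕄} (hm : m ∈ skewAdjoint 𝕄) :
    liftMap L V y κ hw hW m ∈ skewAdjoint 𝕄 := by
  rw [liftMap_apply]
  exact pushDir_mem_skewAdjoint L hV (isSkewDir_bondDir _ _ hm) _ κ fun r => (hW r).trans_lt (by linarith)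

/-- **SKEW PREIMAGES**: a skew `φ(c)` has a SKEW preimage with `|m| ≤ 2L^d|φ(c)|`. [folklore] -/
theorem exists_preimage_skew [Nonempty n] {L : ℕ} (hL : 1 ≤ L) {V : Site d → Fin d → 𝕄ˣ} (hV : IsUnitaryCfg V)
    (y : Site d) (κ : Fin d) {w : ℝ} (hw0 : 0 ≤ w) (hwL : 2044 * (L : ℝ) ^ d * w ≤ 1) (hw : w ≤ 1 / 32)
    (hW : LoopBound L V y κ w) {φ : 𝕄} (hφ : φ ∈ skewAdjoint 𝕄) :
    ∃ m : 𝕄, m ∈ skewAdjoint 𝕄 ∧ liftMap L V y κ hw hW m = φ ∧ ‖m‖ ≤ 2 * (L : ℝ) ^ d * ‖φ‖ := by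
  have hLd : (0 : ℝ) < (L : ℝ) ^ d := pow_pos (by exact_mod_cast hL) d
  -- restrict to the skew-adjoint submodule (Mathlib's `skewAdjoint.submodule ℝ 𝕄`)
  have hmaps : ∀ x ∈ skewAdjoint.submodule ℝ 𝕄, liftMap L V y κ hw hW x ∈ skewAdjoint.submodule ℝ 𝕄 :=
    fun x hx => liftMap_mem_skew hV y κ hw hW hx
  set T := (liftMap L V y κ hw hW).restrict hmaps with hT
  have hinj : Function.Injective T := by
    intro a b h
    have h' : liftMap L V y κ hw hW a = liftMap L V y κ hw hW b := by
      have := congrArg Subtype.val h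
      simpa [hT] using this
    have h1 := norm_liftMap_ge hL hV y κ hw0 hwL hw hW ((a : 𝕄) - b)
    rw [map_sub, h', sub_self, norm_zero] at h1
    have h2 : ‖(a : 𝕄) - b‖ ≤ 0 := by
      by_contra hc
      have : 0 < ((L : ℝ) ^ d)⁻¹ / 2 * ‖(a : 𝕄) - b‖ := mul_pos (by positivity) (lt_of_not_ge hc)
      linarith
    exact Subtype.ext (sub_eq_zero.mp (norm_le_zero_iff.mp h2))
  obtain ⟨m, hm⟩ := (LinearMap.injective_iff_surjective.mp hinj) ⟨φ, hφ⟩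
  have hm' : liftMap L V y κ hw hW m = φ := by
    have := congrArg Subtype.val hm
    simpa [hT] using this
  refine ⟨m, m.2, hm', ?_⟩
  have h1 := norm_liftMap_ge hL hV y κ hw0 hwL hw hW m
  rw [hm'] at h1
  have e : 2 * (L : ℝ) ^ d * (((L : ℝ) ^ d)⁻¹ / 2 * ‖(m : 𝕄)‖) = ‖(m : 𝕄)‖ := by field_simp
  calc ‖(m : 𝕄)‖ = 2 * (L : ℝ) ^ d * (((L : ℝ) ^ d)⁻¹ / 2 * ‖(m : 𝕄)‖) := e.symm
    _ ≤ 2 * (L : ℝ) ^ d * ‖φ‖ := mul_le_mul_of_nonneg_left h1 (by positivity)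

end

end Summit.QuantumFields.BalabanUV.T4Continuum.AveragingDeficitLiftMap
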